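import Literature.NumberTheory.EllipticCurves.Rank1Residual.Typed.PAdicCertificateGoodOrdinary
import Literature.NumberTheory.EllipticCurves.PAdicBSDSkinnerUrbanProofs
import Literature.NumberTheory.EllipticCurves.IwasawaOrderOfVanishing
import Literature.NumberTheory.EllipticCurves.CanonicalPAdicHeightHolds
import Literature.NumberTheory.EllipticCurves.ComplexMultiplicationBurungaleFlachPrimaryProofs
import Summits.BirchSwinnertonDyer.BirchSwinnertonDyer.Theorems.PAdicOrderV2PadicBSDrankNoExcessOfMainConjecture
import HarnessLib

/-!
# BirchSwinnertonDyer — rank-2 `Ш[p^∞]` cell: the EXACT ORDER of `Ш(E/ℚ)[p^∞]` at a certified `(E, p)`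

HONEST FRAMING (cell `b2b-bsdr2sha`, run/shared/lean/b2b/bsd-rank2-sha/): per-pair certified
theorems «cited hypotheses ∧ certified computation ⇒ `Ш(E/ℚ)[p^∞]` finite of order `p^k`» for
rank-2 curves at good ordinary primes; NO claim on BSD in rank `≥ 2`, no class-level theorem, every
published input is a NAMED HYPOTHESIS of the tree (nothing is asserted or minted here).

## What this file proves (theorems only; no definition, no new named fact)

The sibling observatory cell (`Rank2ObservatoryPadicRow.lean`, Kato + Perrin-Riou–Schneider) proves,
at a certified cell `(E, p)`, that `Ш(E/ℚ)[p^∞]` is FINITE and the canonical `p`-adic height is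
non-degenerate; its `Rank2ObservatoryAnomHeightFree.lean` gives the ORDER `#Ш[p^∞] = 1` only at
"unit cells" (`[T^r] L_p` a unit, `p` non-anomalous, `p ∤ ∏ c_ℓ`). The rank-`≤ 1` cell's
`padicBSD_inequality_of_kato_of_surjective_pow` is the one-sided bound from Kato's divisibility.
HERE the two-sided statement: with the cyclotomic MAIN CONJECTURE as printed by Skinner–Urban
(Invent. Math. 195 (2014), Thm. 3.6.9: `E` good ordinary at `p ≥ 3`, `ρ̄_{E,p}` irreducible, a prime
`ℓ ‖ N`, `ℓ ≠ p`, at which `ρ̄_{E,p}` is ramified; equality `char_Λ X(E/ℚ_∞) = (L_p(E,T))` in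
`Λ = ℤ_p⟦T⟧` when `ρ_{E,p}` is surjective — tree named fact `skinner_urban_main_conjecture`, taken
as the hypothesis `hSU`) and the Perrin-Riou–Schneider leading-term theorem (Balakrishnan–Müller–Stein,
Math. Comp. 85 (2016), Thm. 1.7 at `p > 2` — tree named fact `Schneider1985_order_charGenerator_odd`,
hypothesis `hS`), the generator `g` of `char_Λ X` with `ι g = L_p(E,T)` feeds PRS DIRECTLY, so the
unit `u ∈ ℤ_p^×` of BMS Thm. 1.7 (3) is the only slack and the `p`-adic valuation of `#Ш(E/ℚ)[p^∞]`
is DETERMINED: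

  `ord_p #Ш(E/ℚ)[p^∞] = ord_p [T^r]L_p(E,T) + r + 2·ord_p #E(ℚ)_tors − 2·ord_p #Ẽ(𝔽_p)
                        − ord_p ∏_ℓ c_ℓ − ord_p Reg_p(E)`                                   (★)

(`r = rank_ℤ E(ℚ) = ord_{T=0} L_p(E,T)`; `ord_p log_p(1+p) = 1`; `1 − α⁻¹ = unit · #Ẽ(𝔽_p)`,
tree `exists_unit_one_sub_unitRoot_inv`; `Reg_p` the regulator of THE canonical cyclotomic height in
the Stein–Wuthrich normalisation, `PAdicHeightData.IsCanonical`). This is the computation of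
W. Stein and C. Wuthrich, *Algorithms for the arithmetic of elliptic curves using Iwasawa theory*,
Math. Comp. 82 (2013), §§3–4, §8 and Alg. 11.1 ("if `ρ̄` is surjective and the main conjecture
holds, `#Ш(E/ℚ)[p^∞]` equals the `p`-part of the `p`-adic analytic order of `Ш`"), as a kernel
theorem from the tree's named facts.

* `finite_sha_and_valuation_eq_of_mainConjecture` — (★) at an odd good ordinary `p ≥ 3`, given
  `ρ̄_{E,p^n}` surjective for all `n` (`hsurj`), `Irr`, `Ram`, THE canonical height datum `Dh` and the
  computed `ord_{T=0} L_p = rank` (`hord`); also `Ш[p^∞]` finite and `Reg_p ≠ 0`.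
* `card_shaPrimary_eq_pow_of_mainConjecture` — the same with the two certified valuations
  `ord_p [T^r]L_p = a` (L-side engines) and `ord_p Reg_p = b` (height engines) as hypotheses:
  `#Ш(E/ℚ)[p^∞] = p^k` with `k = a + r + 2·ord_p #E(ℚ)_tors − 2·ord_p #Ẽ(𝔽_p) − ord_p ∏c_ℓ − b`.
* `rank_eq_and_order_eq_of_mainConjecture` — the census squeeze WITHOUT a separate Kato
  hypothesis: `r ≤ rank` (rank certificate) and `[T^r] L_p ≠ 0` (`p`-adic cell certificate) give
  `rank = r = ord_{T=0} L_p` (S–U's statement contains `X` torsion and `char X = (g)`, `ι g = L_p`).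
* The ROW THEOREMS (hypotheses = exactly S–U's printed bullets `GoodOrd`, `Irr W p`, `Ram W p` at
  `p ≥ 5`, resp. `p = 3` with Wuthrich's Lemma 20; `ρ_{E,p^∞}` surjective is then a THEOREM:
  `surj_of_irr_of_ram` + Serre) are in the companion `Rank2ShaOrderRow.lean`.

NORMALISATIONS (for the engine seats). `[T^r] L_p` is the coefficient of the tree's
`padicLFunction f (unitRoot W p)`, built on the plus modular symbols of `f` normalised by `Ω⁺_f`
(`PAdicLFunction.lean`; `T = γ_cyc − 1`, `γ_cyc = 1 + p` for odd `p`); an engine working with the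
Néron period `Ω_E` computes `ϖ · [T^r] L_p`, `ϖ · Ω_E = Ω⁺_f`, and must either certify `ord_p ϖ = 0`
(no `p`-isogeny, `p ∤` Manin constant — automatic bookkeeping when the symbol table is rescaled by a
`p`-adic unit `D`, as in `Rank2ObservatoryPadicSymbolTableL.lean`) or report `a` for `f`'s
normalisation. `Reg_p(E, Dh)` is the Gram determinant of THE canonical cyclotomic height in the
Stein–Wuthrich normalisation `ĥ_p(P) = log_p(den x(P)) − 2 log_p σ_p(P)` (`= −2p ×` the
Mazur–Stein–Tate height; so `b = r + ord_p Reg^{MST}` at odd `p`), `CanonicalPAdicHeight.lean`.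

What is NOT claimed: nothing at `p = 2`, supersingular or bad `p`; nothing when `E[p]` is reducible
or no multiplicative `ℓ` with `p ∤ v_ℓ(Δ_min)` exists (then S–U Thm. 3.6.9 as printed does not
apply: the row records the failing hypothesis); the `p`-adic valuations `a`, `b` and the integers
`#E(ℚ)_tors`, `∏ c_ℓ`, `#Ẽ(𝔽_p)` are per-curve INPUTS (two engines each, cell rule), not derived here.

References: C. Skinner, E. Urban, Invent. Math. 195 (2014), Thm. 3.6.9 (p. 45) [SkinnerUrban2014];
K. Kato, Astérisque 295 (2004), Thm. 17.4 [Kato2004Asterisque]; P. Schneider, Invent. Math. 79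
(1985) [Schneider1985]; B. Perrin-Riou, Mém. SMF 17 (1984); J. Balakrishnan, J. S. Müller, W. Stein,
Math. Comp. 85 (2016), Thm. 1.7 [BalakrishnanMullerStein2015]; W. Stein, C. Wuthrich, Math. Comp. 82
(2013), §§3–4, §8, Alg. 11.1 [SteinWuthrich2013]; J.-P. Serre, Invent. Math. 15 (1972), Prop. 15 and
IV §3.4 [Serre1972]; C. Wuthrich, Doc. Math. 19 (2014), Lemma 20 [Wuthrich2014]; B. Mazur, J. Tate,
J. Teitelbaum, Invent. Math. 84 (1986), §I.13 [MazurTateTeitelbaum1986Invent]; B. Mazur, W. Stein,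
J. Tate, Doc. Math. Extra Vol. (2006), §1 [MazurSteinTate2006].
-/

set_option autoImplicit false

-- single-conjunct summit: `Summit.BirchSwinnertonDyer.BirchSwinnertonDyer.…` repeats the name by design
set_option linter.dupNamespace false

noncomputable section

open scoped Classical MatrixGroups ModularForm

open CongruenceSubgroup WeierstrassCurve Literature.NumberTheory.EllipticCurves
  Literature.NumberTheory.EllipticCurves.ModularForms
  Literature.NumberTheory.EllipticCurves.Rank1Residual
  Literature.NumberTheory.EllipticCurves.Wuthrich2014

open Summit.BirchSwinnertonDyer.BirchSwinnertonDyer.Theorems (order_iwasawaToPowerSeries)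

namespace Summit.BirchSwinnertonDyer.BirchSwinnertonDyer.Rank2Sha

/-! ## §1. The exact valuation of `#Ш(E/ℚ)[p^∞]` from the integral main conjecture -/

/-- **Exact order of `Ш(E/ℚ)[p^∞]` from the main conjecture and Perrin-Riou–Schneider** (the
Stein–Wuthrich identity (★) of the module docstring). `W/ℚ` globally minimal elliptic, `p ≥ 3` good
ordinary (`hgood`, `hordp`), `E[p]` irreducible (`hirr`), a multiplicative `ℓ ≠ p` with
`p ∤ v_ℓ(Δ_min)` (`hram`, = S–U's "(ram)"), `ρ̄_{E,p^n}` surjective for every `n` (`hsurj`), `f` the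
newform of `E` (`hf`), `Dh` THE canonical `p`-adic height datum (`hDh`); named facts `hSU`
(Skinner–Urban Thm. 3.6.9 for every cyclotomic datum) and `hS` (BMS Thm. 1.7, `p > 2`); computed:
`ord_{T=0} L_p(f, α_p, T) = rank_ℤ E(ℚ)` (`hord`). Then `Ш(E/ℚ)[p^∞]` is finite, `Reg_p(E, Dh) ≠ 0`, and
`ord_p #Ш[p^∞] + ord_p((1 − α⁻¹)² · ∏c_ℓ · Reg_p) = ord_p([T^r]L_p · log_p(γ_cyc)^r · #E(ℚ)_tors²)`.
Proof: S–U (3) gives `g ∈ Λ` with `ι g = L_p` and `char_Λ X = (g)`; `ord g = ord L_p = rank`, so BMS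
Thm. 1.7 (2)–(3) apply to `f_E = g`, whose `r`-th coefficient IS `[T^r] L_p`.
[cite: SkinnerUrban2014, Thm. 3.6.9 (p. 45)] [cite: BalakrishnanMullerStein2015, Thm. 1.7]
[cite: SteinWuthrich2013, §§3–4 and §8] -/
theorem finite_sha_and_valuation_eq_of_mainConjecture
    (hS : Schneider1985_order_charGenerator_odd)
    (W : WeierstrassCurve ℚ) [W.IsElliptic] [W.IsGloballyMinimal] (p : ℕ) [Fact p.Prime]
    {N : ℕ} [NeZero N] (f : CuspForm (Gamma0 N) 2)
    (hSU : ∀ (κ : ZpExtension ℚ p) (γ : Field.absoluteGaloisGroup ℚ),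
      skinner_urban_main_conjecture W p (κ := κ) (γ := γ) (f := f))
    (hp : 3 ≤ p) (hgood : W.HasGoodReductionAtPrime p) (hordp : ¬ (p : ℤ) ∣ W.frobeniusTrace p)
    (hirr : W.HasIrreducibleModPGaloisRep p) (hram : Ram W p)
    (hsurj : ∀ n : ℕ, W.HasSurjectiveModNGaloisRep (p ^ n : ℕ)) (hf : IsNewformOf W f)
    (Dh : PAdicHeightData W p) (hDh : Dh.IsCanonical)
    (hord : (padicLFunction f (unitRoot W p : ℚ_[p])).order = W.mordellWeilRank) :
    Finite (AddCommGroup.primaryComponent W.sha p) ∧ SchneiderConjecture Dh ∧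
      (padicValNat p (Nat.card (AddCommGroup.primaryComponent W.sha p)) : ℤ) +
          ((1 - (unitRoot W p : ℚ_[p])⁻¹) ^ 2 * (W.tamagawaProduct : ℚ_[p]) *
            padicRegulator Dh).valuation =
        (PowerSeries.coeff W.mordellWeilRank (padicLFunction f (unitRoot W p : ℚ_[p])) *
          (padicLog p (cyclotomicGenerator p) ^ W.mordellWeilRank *
            (W.torsionOrder : ℚ_[p]) ^ 2)).valuation := by
  have hp2 : p ≠ 2 := by omega
  have hordin : IsOrdinaryAt W p := ⟨hgood, hordp⟩
  -- the cyclotomic setting, the Iwasawa module, S–U's Thm. 3.6.9 (3): `char X = (g)`, `ι g = L_p`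
  obtain ⟨κ, hκ, γ, hγ, hγ'⟩ := exists_isCyclotomic_isTopGenerator_isCyclotomicVariable_holds p
  obtain ⟨D⟩ := W.nonempty_selmerDualData_holds κ γ hγ
  haveI : Module.Finite (IwasawaAlgebra p) D.X := D.module_finite_holds hγ
  obtain ⟨hX, -, h3⟩ := hSU κ γ hp hgood hordp hirr hram hκ hγ hγ' hf D
  obtain ⟨g, hιg, hchar⟩ := h3 hsurj
  -- Perrin-Riou–Schneider for the generator `g`
  obtain ⟨-, h2, hLC⟩ := hS W p hp2 hgood hordp κ γ hκ hγ hγ' D hX g hchar Dh hDh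
  have hordg : g.order = W.mordellWeilRank := by
    rw [← order_iwasawaToPowerSeries p g, hιg]; exact hord
  obtain ⟨hSch, hfin⟩ := h2.mp hordg
  obtain ⟨u, hu⟩ := hLC hSch hfin
  refine ⟨hfin, hSch, ?_⟩
  haveI := hfin
  -- `[T^r] g = [T^r] L_p`
  have hcoeff : ((PowerSeries.coeff W.mordellWeilRank g : ℤ_[p]) : ℚ_[p]) =
      PowerSeries.coeff W.mordellWeilRank (padicLFunction f (unitRoot W p : ℚ_[p])) := by
    rw [← coeff_iwasawaToPowerSeries p g, hιg]
  have key : PowerSeries.coeff W.mordellWeilRank (padicLFunction f (unitRoot W p : ℚ_[p])) *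
        (padicLog p (cyclotomicGenerator p) ^ W.mordellWeilRank * (W.torsionOrder : ℚ_[p]) ^ 2) =
      ((u : ℤ_[p]) : ℚ_[p]) *
        ((1 - (unitRoot W p : ℚ_[p])⁻¹) ^ 2 *
          ((Nat.card (AddCommGroup.primaryComponent W.sha p) : ℚ_[p]) *
            padicRegulator Dh * W.tamagawaProduct)) := by
    rw [← hcoeff, ← mul_assoc]; exact hu
  -- the non-vanishing factors
  obtain ⟨u₂, hu₂⟩ := exists_unit_one_sub_unitRoot_inv p W hordin
  have hε0 : (1 - (unitRoot W p : ℚ_[p])⁻¹) ^ 2 ≠ 0 := by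
    rw [hu₂]
    refine pow_ne_zero 2 (mul_ne_zero (coe_units_ne_zero p u₂) ?_)
    exact_mod_cast (W.reductionPointCount_pos p).ne'
  have hc0 : (W.tamagawaProduct : ℚ_[p]) ≠ 0 := by
    exact_mod_cast (W.tamagawaProduct_pos_holds : 0 < W.tamagawaProduct).ne'
  have hR0 : padicRegulator Dh ≠ 0 := hSch
  have hS0 : (Nat.card (AddCommGroup.primaryComponent W.sha p) : ℚ_[p]) ≠ 0 := by
    exact_mod_cast Nat.card_pos.ne'
  have hSR0 := mul_ne_zero hS0 hR0
  have hSRT0 := mul_ne_zero hSR0 hc0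
  -- valuations
  have hval := congrArg Padic.valuation key
  rw [Padic.valuation_mul (coe_units_ne_zero p u) (mul_ne_zero hε0 hSRT0),
    valuation_coe_units_eq_zero, zero_add, Padic.valuation_mul hε0 hSRT0,
    Padic.valuation_mul hSR0 hc0, Padic.valuation_mul hS0 hR0, Padic.valuation_natCast] at hval
  rw [hval, Padic.valuation_mul (mul_ne_zero hε0 hc0) hR0, Padic.valuation_mul hε0 hc0]
  ring

/-! ## §2. The order as an explicit power of `p` -/

/-- **`#Ш(E/ℚ)[p^∞] = p^k` with `k` COMPUTED** (formula (★)). Hypotheses of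
`finite_sha_and_valuation_eq_of_mainConjecture`, plus the two certified `p`-adic valuations:
`ord_p [T^r] L_p(f, α_p, T) = a` (`hcoeff`; L-side, two engines) and `ord_p Reg_p(E, Dh) = b` (`hreg`;
H-side, two engines; `b` may be negative at anomalous `p` or when `p ∣ ∏c_ℓ`). Then
`#Ш(E/ℚ)[p^∞] = p^k`, `k = a + r + 2·ord_p #E(ℚ)_tors − 2·ord_p #Ẽ(𝔽_p) − ord_p ∏c_ℓ − b`
(`r = rank_ℤ E(ℚ)`, `#Ẽ(𝔽_p) = W.reductionPointCount p`; `ord_p log_p(1+p) = 1` and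
`ord_p(1 − α⁻¹) = ord_p #Ẽ(𝔽_p)` by the tree's `exists_unit_padicLog_cyclotomicGenerator`,
`exists_unit_one_sub_unitRoot_inv`). [cite: SteinWuthrich2013, §§3–4, §8 and Alg. 11.1]
[cite: SkinnerUrban2014, Thm. 3.6.9 (p. 45)] [cite: BalakrishnanMullerStein2015, Thm. 1.7] -/
theorem card_shaPrimary_eq_pow_of_mainConjecture
    (hS : Schneider1985_order_charGenerator_odd)
    (W : WeierstrassCurve ℚ) [W.IsElliptic] [W.IsGloballyMinimal] (p : ℕ) [Fact p.Prime]
    {N : ℕ} [NeZero N] (f : CuspForm (Gamma0 N) 2)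
    (hSU : ∀ (κ : ZpExtension ℚ p) (γ : Field.absoluteGaloisGroup ℚ),
      skinner_urban_main_conjecture W p (κ := κ) (γ := γ) (f := f))
    (hp : 3 ≤ p) (hgood : W.HasGoodReductionAtPrime p) (hordp : ¬ (p : ℤ) ∣ W.frobeniusTrace p)
    (hirr : W.HasIrreducibleModPGaloisRep p) (hram : Ram W p)
    (hsurj : ∀ n : ℕ, W.HasSurjectiveModNGaloisRep (p ^ n : ℕ)) (hf : IsNewformOf W f)
    (Dh : PAdicHeightData W p) (hDh : Dh.IsCanonical)
    (hord : (padicLFunction f (unitRoot W p : ℚ_[p])).order = W.mordellWeilRank)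
    {a b : ℤ}
    (hcoeff : (PowerSeries.coeff W.mordellWeilRank
      (padicLFunction f (unitRoot W p : ℚ_[p]))).valuation = a)
    (hreg : (padicRegulator Dh).valuation = b) :
    Finite (AddCommGroup.primaryComponent W.sha p) ∧
      ∃ k : ℕ, Nat.card (AddCommGroup.primaryComponent W.sha p) = p ^ k ∧
        (k : ℤ) = a + W.mordellWeilRank + 2 * padicValNat p W.torsionOrder -
          2 * padicValNat p (W.reductionPointCount p) - padicValNat p W.tamagawaProduct - b := by
  have hp2 : p ≠ 2 := by omega
  have hordin : IsOrdinaryAt W p := ⟨hgood, hordp⟩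
  obtain ⟨hfin, hSch, hval⟩ := finite_sha_and_valuation_eq_of_mainConjecture hS W p f hSU hp hgood
    hordp hirr hram hsurj hf Dh hDh hord
  haveI := hfin
  refine ⟨hfin, ?_⟩
  obtain ⟨k, hk⟩ := exists_natCard_primaryComponent_eq_pow (A := W.sha) p
  refine ⟨k, hk, ?_⟩
  have hvk : padicValNat p (Nat.card (AddCommGroup.primaryComponent W.sha p)) = k := by
    rw [hk, padicValNat.prime_pow]
  -- the individual valuations
  obtain ⟨u₂, hu₂⟩ := exists_unit_one_sub_unitRoot_inv p W hordin
  have hN0 : (W.reductionPointCount p : ℚ_[p]) ≠ 0 := by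
    exact_mod_cast (W.reductionPointCount_pos p).ne'
  have hε0 : (1 - (unitRoot W p : ℚ_[p])⁻¹) ≠ 0 := by
    rw [hu₂]; exact mul_ne_zero (coe_units_ne_zero p u₂) hN0
  have hvε : ((1 - (unitRoot W p : ℚ_[p])⁻¹) ^ 2).valuation =
      2 * (padicValNat p (W.reductionPointCount p) : ℤ) := by
    rw [Padic.valuation_pow, hu₂, Padic.valuation_mul (coe_units_ne_zero p u₂) hN0,
      valuation_coe_units_eq_zero, zero_add, Padic.valuation_natCast]
    push_cast; ring
  have hc0 : (W.tamagawaProduct : ℚ_[p]) ≠ 0 := by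
    exact_mod_cast (W.tamagawaProduct_pos_holds : 0 < W.tamagawaProduct).ne'
  have ht0 : (W.torsionOrder : ℚ_[p]) ≠ 0 := by
    exact_mod_cast (W.torsionOrder_pos_holds : 0 < W.torsionOrder).ne'
  have hR0 : padicRegulator Dh ≠ 0 := hSch
  obtain ⟨u₃, hu₃⟩ := exists_unit_padicLog_cyclotomicGenerator p hp2
  have hp0 : (p : ℚ_[p]) ≠ 0 := Nat.cast_ne_zero.mpr (Fact.out : p.Prime).ne_zero
  have hlog0 : padicLog p (cyclotomicGenerator p : ℚ_[p]) ≠ 0 := by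
    rw [hu₃]; exact mul_ne_zero hp0 (coe_units_ne_zero p u₃)
  have hvlog : (padicLog p (cyclotomicGenerator p : ℚ_[p]) ^ W.mordellWeilRank).valuation =
      (W.mordellWeilRank : ℤ) := by
    rw [Padic.valuation_pow, hu₃, Padic.valuation_mul hp0 (coe_units_ne_zero p u₃),
      valuation_coe_units_eq_zero, add_zero, Padic.valuation_p]
    ring
  have hvtors : ((W.torsionOrder : ℚ_[p]) ^ 2).valuation = 2 * (padicValNat p W.torsionOrder : ℤ) := by
    rw [Padic.valuation_pow, Padic.valuation_natCast]
    push_cast; ring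
  have hcoeff0 : PowerSeries.coeff W.mordellWeilRank (padicLFunction f (unitRoot W p : ℚ_[p])) ≠ 0 := by
    have hL0 : padicLFunction f (unitRoot W p : ℚ_[p]) ≠ 0 := by
      intro h0
      rw [h0, PowerSeries.order_zero] at hord
      exact ENat.top_ne_coe _ hord
    have h1 := PowerSeries.coeff_order hL0
    rwa [hord, ENat.toNat_coe] at h1
  -- assemble
  rw [Padic.valuation_mul (mul_ne_zero (pow_ne_zero 2 hε0) hc0) hR0,
    Padic.valuation_mul (pow_ne_zero 2 hε0) hc0, hvε, Padic.valuation_natCast, hreg,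
    Padic.valuation_mul hcoeff0 (mul_ne_zero (pow_ne_zero _ hlog0) (pow_ne_zero 2 ht0)),
    hcoeff, Padic.valuation_mul (pow_ne_zero _ hlog0) (pow_ne_zero 2 ht0), hvlog, hvtors, hvk] at hval
  linarith

/-! ## §3. The census squeeze from the main conjecture: `rank = r = ord_{T=0} L_p` -/

/-- **Rank and order of vanishing at a certified cell, from Skinner–Urban alone** (no separate Kato
hypothesis: Thm. 3.6.9 as transcribed contains "`X` is `Λ`-torsion" and `char X = (g)`, `ι g = L_p`).
With `r ≤ rank_ℤ E(ℚ)` (`hlow`, the rank certificate) and `[T^r] L_p(f, α_p, T) ≠ 0` (`hLp`, the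
`p`-adic cell certificate): `rank ≤ ord g = ord L_p ≤ r ≤ rank` (tree theorem
`mordellWeilRank_le_order_charGenerator`, BMS Thm. 1.7 (1) / Greenberg LNM 1716 Lemma 3.1), hence
`rank_ℤ E(ℚ) = r` and `ord_{T=0} L_p = r`. [cite: SkinnerUrban2014, Thm. 3.6.9 (p. 45)]
[cite: BalakrishnanMullerStein2015, Thm. 1.7] [cite: GreenbergLNM1716, §3 Lemma 3.1] -/
theorem rank_eq_and_order_eq_of_mainConjecture
    (W : WeierstrassCurve ℚ) [W.IsElliptic] [W.IsGloballyMinimal] (p : ℕ) [Fact p.Prime]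
    {N : ℕ} [NeZero N] (f : CuspForm (Gamma0 N) 2)
    (hSU : ∀ (κ : ZpExtension ℚ p) (γ : Field.absoluteGaloisGroup ℚ),
      skinner_urban_main_conjecture W p (κ := κ) (γ := γ) (f := f))
    (hp : 3 ≤ p) (hgood : W.HasGoodReductionAtPrime p) (hordp : ¬ (p : ℤ) ∣ W.frobeniusTrace p)
    (hirr : W.HasIrreducibleModPGaloisRep p) (hram : Ram W p)
    (hsurj : ∀ n : ℕ, W.HasSurjectiveModNGaloisRep (p ^ n : ℕ)) (hf : IsNewformOf W f)
    {r : ℕ} (hlow : r ≤ W.mordellWeilRank)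
    (hLp : PowerSeries.coeff r (padicLFunction f (unitRoot W p : ℚ_[p])) ≠ 0) :
    W.mordellWeilRank = r ∧ (padicLFunction f (unitRoot W p : ℚ_[p])).order = r := by
  obtain ⟨κ, hκ, γ, hγ, hγ'⟩ := exists_isCyclotomic_isTopGenerator_isCyclotomicVariable_holds p
  obtain ⟨D⟩ := W.nonempty_selmerDualData_holds κ γ hγ
  haveI : Module.Finite (IwasawaAlgebra p) D.X := D.module_finite_holds hγ
  obtain ⟨hX, -, h3⟩ := hSU κ γ hp hgood hordp hirr hram hκ hγ hγ' hf D
  obtain ⟨g, hιg, hchar⟩ := h3 hsurj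
  have h1 : (W.mordellWeilRank : ℕ∞) ≤ g.order := W.mordellWeilRank_le_order_charGenerator hγ D hX hchar
  have hk : (W.mordellWeilRank : ℕ∞) ≤ (padicLFunction f (unitRoot W p : ℚ_[p])).order := by
    rw [← hιg, order_iwasawaToPowerSeries p g]; exact h1
  have hle : (padicLFunction f (unitRoot W p : ℚ_[p])).order ≤ r := PowerSeries.order_le r hLp
  have hrank : W.mordellWeilRank ≤ r := by exact_mod_cast hk.trans hle
  have hr : W.mordellWeilRank = r := le_antisymm hrank hlow
  refine ⟨hr, le_antisymm hle ?_⟩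
  rw [← hr]
  exact hk

end Summit.BirchSwinnertonDyer.BirchSwinnertonDyer.Rank2Sha

end
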